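import Summits.KontsevichZagierPeriods.KontsevichZagierPeriods.Theses.HyperbolicBloch
import Literature.NumberTheory.Transcendental.KZIdealTetrahedron
import Literature.NumberTheory.Transcendental.SemialgebraicMapsProofs

/-!
# `IsometryMove` (stmt-KontsevichZagierPeriods-3471, route HyperbolicBloch) — line `bruhat-inversion-chain`

The crux: for algebraic `a b c d : ℂ` with `ad − bc ≠ 0` and `ε = ±1`, the Poincaré extension
`g(w, t) = (((aw+b)·conj(cw+d) + a·conj(c)·t²)/N, ‖ad−bc‖·t/N)`, `N = |cw+d|² + |c|²t²`, `w = x + iεy`,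
transports every KZ integral representation `[σ, t⁻³]` (`σ ⊆ {t > 0}`) to an EQUIVALENT representation
`[g σ, t⁻³]`.

Line (Bruhat cells `B ∪ BwB` of `PSL₂(ℂ)` read in `ℍ³`; Benedetti–Petronio 1992, proof of Prop. A.3.5(2)):
* `c = 0`: `g` is ONE boundary-fixing similarity `S(α, β, η) : (x, y, t) ↦ (α(x + iηy) + β, ‖α‖ t)` with
  `α = a/d`, `β = b/d`, `η = ε` (`stub_affineCase`), and a similarity with algebraic `α ≠ 0`, `β` and
  `η = ±1` is ONE `KZ.changeOfVariablesRel` move (`stub_similarityMove` + `stub_moveTransport`: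
  `|det DS| = ‖α‖³ = (S₃/t)³`);
* `c ≠ 0`: `g = S(−(ad−bc)/c, a/c, 1) ∘ J ∘ S(c, d, ε)` pointwise on `{t > 0}` (`stub_bruhatFactorisation`),
  where `J(p) = (p₀, −p₁, p₂)/|p|²` is the unit inversion composed with the mirror (the Poincaré extension
  of `w ↦ 1/w`; `|det DJ| = |p|⁻⁶ = (J₃/t)³`, `stub_inversionMove`); each factor is one move between
  successive image representations (`stub_moveTransport` builds `[Φ σ, t⁻³]` — `ℚ`-semialgebraic image
  by Tarski–Seidenberg, integrability of `t⁻³` on the image by the change-of-variables formula — and gives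
  the move), and `KZ.Equivalent` is transitive.

References: R. Benedetti, C. Petronio, *Lectures on Hyperbolic Geometry* (1992), A.3.5, A.4.2–A.4.4;
M. Kontsevich, D. Zagier, *Periods* (2001), §1.2 rule (2); J. Bochnak, M. Coste, M.-F. Roy,
*Real Algebraic Geometry* (1998), Prop. 2.2.6–2.2.7.
-/

noncomputable section

open Set MeasureTheory
open Literature.NumberTheory.Transcendental Literature.ModelTheory.ExponentialFields

namespace Summit.KontsevichZagierPeriods.HyperbolicBloch.IsometryMove

/-! ## Stubs of the line (registered on stmt-KontsevichZagierPeriods-3471) -/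

/-- STUB (similarity move data). A boundary-fixing similarity `S(α, β, η) : (x, y, t) ↦ (α(x + iηy) + β, ‖α‖t)`
with `α ≠ 0`, `α, β` algebraic and `η = ±1` is, on every `ℚ`-semialgebraic `σ ⊆ {t > 0}`, a `ℚ`-semialgebraic
injective map into `{t > 0}` with a derivative of determinant `±‖α‖³`, so that `t⁻³ = (S p)₃⁻³ · |det DS|`.
[cite: BenedettiPetronio1992, A.3.5] -/
theorem stub_similarityMove : ∀ (α β : ℂ) (η : ℝ), IsAlgebraic ℚ α → IsAlgebraic ℚ β → α ≠ 0 → (η = 1 ∨ η = -1) → ∀ (S : (Fin 3 → ℝ) → (Fin 3 → ℝ)), (∀ p, S p = ![(α * (Complex.mk (p 0) (η * p 1)) + β).re, (α * (Complex.mk (p 0) (η * p 1)) + β).im, ‖α‖ * p 2]) → ∀ (σ : Set (Fin 3 → ℝ)), Literature.ModelTheory.ExponentialFields.IsSemialgebraic ℚ σ → σ ⊆ {p | 0 < p 2} → Literature.NumberTheory.Transcendental.IsSemialgebraicMapOn ℚ σ S ∧ Set.InjOn S σ ∧ Set.MapsTo S σ {p | 0 < p 2} ∧ ∃ S' : (Fin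 3 → ℝ) → ((Fin 3 → ℝ) →L[ℝ] (Fin 3 → ℝ)), ∀ x ∈ σ, HasFDerivWithinAt S (S' x) σ x ∧ 1 / x 2 ^ 3 = 1 / (S x) 2 ^ 3 * |(S' x).det| := by
  sorry

/-- STUB (inversion move data). The unit inversion composed with the mirror,
`J(p) = (p₀, −p₁, p₂)/(p₀² + p₁² + p₂²)` (Poincaré extension of `w ↦ 1/w`), is, on every `ℚ`-semialgebraic
`σ ⊆ {t > 0}`, a `ℚ`-semialgebraic injective map into `{t > 0}` with a derivative of determinant `|p|⁻⁶` in
absolute value, so that `t⁻³ = (J p)₃⁻³ · |det DJ|`. [cite: BenedettiPetronio1992, A.3.5] -/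
theorem stub_inversionMove : ∀ (J : (Fin 3 → ℝ) → (Fin 3 → ℝ)), (∀ p, J p = ![p 0 / (p 0 ^ 2 + p 1 ^ 2 + p 2 ^ 2), -p 1 / (p 0 ^ 2 + p 1 ^ 2 + p 2 ^ 2), p 2 / (p 0 ^ 2 + p 1 ^ 2 + p 2 ^ 2)]) → ∀ (σ : Set (Fin 3 → ℝ)), Literature.ModelTheory.ExponentialFields.IsSemialgebraic ℚ σ → σ ⊆ {p | 0 < p 2} → Literature.NumberTheory.Transcendental.IsSemialgebraicMapOn ℚ σ J ∧ Set.InjOn J σ ∧ Set.MapsTo J σ {p | 0 < p 2} ∧ ∃ J' : (Fin 3 → ℝ) → ((Fin 3 → ℝ) →L[ℝ] (Fin 3 → ℝ)), ∀ x ∈ σ, HasFDerivWithinAt J (J' x) σ x ∧ 1 / x 2 ^ 3 = 1 / (J x) 2 ^ 3 * |(J' x).det| := by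
  sorry

/-- STUB (transport along one move). If `Φ` is `ℚ`-semialgebraic and injective on the domain `σ ⊆ {t > 0}` of a
representation `r = [σ, t⁻³]`, maps it into `{t > 0}` and has there a derivative with `t⁻³ = (Φ p)₃⁻³·|det DΦ|`,
then `[Φ σ, t⁻³]` IS an integral representation (semialgebraic image, Tarski–Seidenberg; integrability by the
change-of-variables formula) and every representation with domain `Φ σ` and integrand `t⁻³` there is
KZ-equivalent to `r` by ONE `changeOfVariablesRel` move. [cite: KontsevichZagier2001, §1.2 rule (2)] -/
theorem stub_moveTransport : ∀ (Φ : (Fin 3 → ℝ) → (Fin 3 → ℝ)) (r : Literature.NumberTheory.Transcendental.KZ.IntegralRep 3), r.domain ⊆ {p | 0 < p 2} → Set.EqOn r.integrand (fun p => 1 / p 2 ^ 3) r.domain → Literature.NumberTheory.Transcendental.IsSemialgebraicMapOn ℚ r.domain Φ → Set.InjOn Φ r.domain → Set.MapsTo Φ r.domain {p | 0 < p 2} → (∃ Φ' : (Fin 3 → ℝ) → ((Fin 3 → ℝ) →L[ℝ] (Fin 3 → ℝ)), ∀ x ∈ r.domain, HasFDerivWithinAt Φ (Φ' x) r.domain x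 ∧ 1 / x 2 ^ 3 = 1 / (Φ x) 2 ^ 3 * |(Φ' x).det|) → (∃ r₁ : Literature.NumberTheory.Transcendental.KZ.IntegralRep 3, r₁.domain = Φ '' r.domain ∧ Set.EqOn r₁.integrand (fun p => 1 / p 2 ^ 3) r₁.domain) ∧ (∀ r' : Literature.NumberTheory.Transcendental.KZ.IntegralRep 3, r'.domain = Φ '' r.domain → Set.EqOn r'.integrand (fun p => 1 / p 2 ^ 3) r'.domain → Literature.NumberTheory.Transcendental.KZ.Equivalent r r') := by
  sorry

/-- STUB (Bruhat factorisation, big cell `c ≠ 0`). On `{t > 0}` the typed Poincaré extension is the composite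
`S(−(ad−bc)/c, a/c, 1) ∘ J ∘ S(c, d, ε)` of two similarities and the unit inversion
(`(aw+b)/(cw+d) = a/c − ((ad−bc)/c)·(cw+d)⁻¹`). [cite: BenedettiPetronio1992, A.3.5] -/
theorem stub_bruhatFactorisation : ∀ (a b c d : ℂ) (ε : ℝ), c ≠ 0 → ∀ (S₁ J S₂ : (Fin 3 → ℝ) → (Fin 3 → ℝ)), (∀ p, S₁ p = ![(c * (Complex.mk (p 0) (ε * p 1)) + d).re, (c * (Complex.mk (p 0) (ε * p 1)) + d).im, ‖c‖ * p 2]) → (∀ p, J p = ![p 0 / (p 0 ^ 2 + p 1 ^ 2 + p 2 ^ 2), -p 1 / (p 0 ^ 2 + p 1 ^ 2 + p 2 ^ 2), p 2 / (p 0 ^ 2 + p 1 ^ 2 + p 2 ^ 2)]) → (∀ p, S₂ p = ![((-(a * d - b * c) / c) * (Complex.mk (p 0) (1 * p 1)) + a / c).re, ((-(a * d - b * c) / c) * (Complex.mk (p 0) (1 * p 1)) + a / c).im, ‖-(a * d - b * c) / c‖ * p 2]) → ∀ (p : Fin 3 → ℝ), 0 < p 2 → (![((a * (Complex.mk (p 0)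 (ε * p 1)) + b) * (starRingEnd ℂ) (c * (Complex.mk (p 0) (ε * p 1)) + d) + a * (starRingEnd ℂ) c * (p 2 : ℂ) ^ 2).re / (Complex.normSq (c * (Complex.mk (p 0) (ε * p 1)) + d) + Complex.normSq c * p 2 ^ 2), ((a * (Complex.mk (p 0) (ε * p 1)) + b) * (starRingEnd ℂ) (c * (Complex.mk (p 0) (ε * p 1)) + d) + a * (starRingEnd ℂ) c * (p 2 : ℂ) ^ 2).im / (Complex.normSq (c * (Complex.mk (p 0) (ε * p 1)) + d) + Complex.normSq c * p 2 ^ 2), ‖a * d - b * c‖ * p 2 / (Complex.normSq (c * (Complex.mk (p 0) (ε * p 1)) + d) + Complex.normSq c * p 2 ^ 2)] : Fin 3 → ℝ) = S₂ (J (S₁ p)) := by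
  sorry

/-- STUB (small cell `c = 0`). For `c = 0` (so `d ≠ 0`) the typed Poincaré extension is the single similarity
`S(a/d, b/d, ε)`. [cite: BenedettiPetronio1992, A.3.5] -/
theorem stub_affineCase : ∀ (a b c d : ℂ) (ε : ℝ), c = 0 → d ≠ 0 → ∀ (S : (Fin 3 → ℝ) → (Fin 3 → ℝ)), (∀ p, S p = ![((a / d) * (Complex.mk (p 0) (ε * p 1)) + b / d).re, ((a / d) * (Complex.mk (p 0) (ε * p 1)) + b / d).im, ‖a / d‖ * p 2]) → ∀ (p : Fin 3 → ℝ), (![((a * (Complex.mk (p 0) (ε * p 1)) + b) * (starRingEnd ℂ) (c * (Complex.mk (p 0) (ε * p 1)) + d) + a * (starRingEnd ℂ) c * (p 2 : ℂ) ^ 2).re / (Complex.normSq (c * (Complex.mk (p 0) (ε * p 1)) + d) + Complex.normSq c * p 2 ^ 2), ((a * (Complex.mk (p 0) (ε * p 1)) + b) * (starRingEnd ℂ) (c * (Complex.mk (p 0) (ε * p 1)) + d) + a * (starRingEnd ℂ) c * (p 2 : ℂ) ^ 2).im / (Complex.normSq (c * (Complex.mk (p 0) (ε * p 1)) + d) +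 Complex.normSq c * p 2 ^ 2), ‖a * d - b * c‖ * p 2 / (Complex.normSq (c * (Complex.mk (p 0) (ε * p 1)) + d) + Complex.normSq c * p 2 ^ 2)] : Fin 3 → ℝ) = S p := by
  sorry

/-! ## Composition: the stubs imply the crux

No definitions are introduced: the similarities `S(α, β, η) p = ((α(p₀ + iηp₁) + β).re, (…).im, ‖α‖p₂)` and the
inversion `J` enter the lemmas below as functions with a defining hypothesis, exactly as `g` enters the crux. -/

/-- One similarity move, in transport form: from `[σ, t⁻³]` (`σ ⊆ {t > 0}`) to an image representation
`[S σ, t⁻³]`, and to any given representation on `S σ` with integrand `t⁻³`.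
[cite: KontsevichZagier2001, §1.2 rule (2)] -/
theorem simil_transport {α β : ℂ} {η : ℝ} (hα : IsAlgebraic ℚ α) (hβ : IsAlgebraic ℚ β) (h0 : α ≠ 0)
    (hη : η = 1 ∨ η = -1) (S : (Fin 3 → ℝ) → (Fin 3 → ℝ))
    (hS : ∀ p, S p = ![(α * (Complex.mk (p 0) (η * p 1)) + β).re, (α * (Complex.mk (p 0) (η * p 1)) + β).im,
      ‖α‖ * p 2])
    (r : KZ.IntegralRep 3) (hσ : r.domain ⊆ {p | 0 < p 2})
    (hint : EqOn r.integrand (fun p => 1 / p 2 ^ 3) r.domain) :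
    (∃ r₁ : KZ.IntegralRep 3, r₁.domain = S '' r.domain ∧
        EqOn r₁.integrand (fun p => 1 / p 2 ^ 3) r₁.domain) ∧
      (∀ r' : KZ.IntegralRep 3, r'.domain = S '' r.domain →
        EqOn r'.integrand (fun p => 1 / p 2 ^ 3) r'.domain → KZ.Equivalent r r') := by
  obtain ⟨hS', hinj, hmaps, hderiv⟩ := stub_similarityMove α β η hα hβ h0 hη S hS
    r.domain r.isSemialgebraic_domain hσ
  exact stub_moveTransport S r hσ hint hS' hinj hmaps hderiv

/-- One inversion move, in transport form. [cite: KontsevichZagier2001, §1.2 rule (2)] -/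
theorem inversion_transport (J : (Fin 3 → ℝ) → (Fin 3 → ℝ))
    (hJ : ∀ p, J p = ![p 0 / (p 0 ^ 2 + p 1 ^ 2 + p 2 ^ 2), -p 1 / (p 0 ^ 2 + p 1 ^ 2 + p 2 ^ 2),
      p 2 / (p 0 ^ 2 + p 1 ^ 2 + p 2 ^ 2)])
    (r : KZ.IntegralRep 3) (hσ : r.domain ⊆ {p | 0 < p 2})
    (hint : EqOn r.integrand (fun p => 1 / p 2 ^ 3) r.domain) :
    (∃ r₁ : KZ.IntegralRep 3, r₁.domain = J '' r.domain ∧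
        EqOn r₁.integrand (fun p => 1 / p 2 ^ 3) r₁.domain) ∧
      (∀ r' : KZ.IntegralRep 3, r'.domain = J '' r.domain →
        EqOn r'.integrand (fun p => 1 / p 2 ^ 3) r'.domain → KZ.Equivalent r r') := by
  obtain ⟨hS', hinj, hmaps, hderiv⟩ := stub_inversionMove J hJ r.domain r.isSemialgebraic_domain hσ
  exact stub_moveTransport J r hσ hint hS' hinj hmaps hderiv

/-- Images of subsets of `{t > 0}` under a similarity with `α ≠ 0` stay in `{t > 0}`. [folklore] -/
theorem simil_image_subset {α β : ℂ} {η : ℝ} (h0 : α ≠ 0) (S : (Fin 3 → ℝ) → (Fin 3 → ℝ))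
    (hS : ∀ p, S p = ![(α * (Complex.mk (p 0) (η * p 1)) + β).re, (α * (Complex.mk (p 0) (η * p 1)) + β).im,
      ‖α‖ * p 2])
    {σ : Set (Fin 3 → ℝ)} (hσ : σ ⊆ {p | 0 < p 2}) : S '' σ ⊆ {p | 0 < p 2} := by
  rintro _ ⟨p, hp, rfl⟩
  have hp2 : 0 < p 2 := hσ hp
  show 0 < S p 2
  simp only [hS, Matrix.cons_val_two, Matrix.tail_cons, Matrix.head_cons]
  exact mul_pos (norm_pos_iff.mpr h0) hp2

/-- Images of subsets of `{t > 0}` under the inversion stay in `{t > 0}`. [folklore] -/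
theorem inversion_image_subset (J : (Fin 3 → ℝ) → (Fin 3 → ℝ))
    (hJ : ∀ p, J p = ![p 0 / (p 0 ^ 2 + p 1 ^ 2 + p 2 ^ 2), -p 1 / (p 0 ^ 2 + p 1 ^ 2 + p 2 ^ 2),
      p 2 / (p 0 ^ 2 + p 1 ^ 2 + p 2 ^ 2)])
    {σ : Set (Fin 3 → ℝ)} (hσ : σ ⊆ {p | 0 < p 2}) : J '' σ ⊆ {p | 0 < p 2} := by
  rintro _ ⟨p, hp, rfl⟩
  have hp2 : 0 < p 2 := hσ hp
  show 0 < J p 2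
  simp only [hJ, Matrix.cons_val_two, Matrix.tail_cons, Matrix.head_cons]
  exact div_pos hp2 (by positivity)

/-- **The crux `IsometryMove` from the stubs of line `bruhat-inversion-chain`**: `c = 0` — one similarity move
(`stub_affineCase`); `c ≠ 0` — `r ∼ [S₁σ] ∼ [J S₁σ] ∼ r'` by three moves (`stub_bruhatFactorisation`),
chained by `KZ.Equivalent.trans`. [cite: BenedettiPetronio1992, A.3.5] -/
theorem isometryMove_proof :
    Summit.KontsevichZagierPeriods.KontsevichZagierPeriods.Theses.HyperbolicBloch.IsometryMove := by
  intro a b c d ε ha hb hc hd hdet hε g hg r r' hσ hint hdom hint'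
  -- the three elementary maps, as functions with defining equations
  obtain ⟨J, hJ⟩ : ∃ J : (Fin 3 → ℝ) → (Fin 3 → ℝ), ∀ p, J p = ![p 0 / (p 0 ^ 2 + p 1 ^ 2 + p 2 ^ 2),
      -p 1 / (p 0 ^ 2 + p 1 ^ 2 + p 2 ^ 2), p 2 / (p 0 ^ 2 + p 1 ^ 2 + p 2 ^ 2)] := ⟨_, fun _ => rfl⟩
  have hSim : ∀ (α β : ℂ) (η : ℝ), ∃ S : (Fin 3 → ℝ) → (Fin 3 → ℝ), ∀ p, S p =
      ![(α * (Complex.mk (p 0) (η * p 1)) + β).re, (α * (Complex.mk (p 0) (η * p 1)) + β).im, ‖α‖ * p 2] :=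
    fun α β η => ⟨_, fun _ => rfl⟩
  by_cases hc0 : c = 0
  · -- small Bruhat cell: one similarity move
    have hd0 : d ≠ 0 := by
      rintro rfl
      apply hdet
      simp [hc0]
    have hα : IsAlgebraic ℚ (a / d) := by simpa [div_eq_mul_inv] using ha.mul hd.inv
    have hβ : IsAlgebraic ℚ (b / d) := by simpa [div_eq_mul_inv] using hb.mul hd.inv
    have hα0 : a / d ≠ 0 := by
      refine div_ne_zero ?_ hd0
      rintro rfl
      apply hdet
      simp [hc0]
    obtain ⟨S, hS⟩ := hSim (a / d) (b / d) ε
    have hgS : EqOn g S r.domain := fun p _ => by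
      rw [hg p]
      exact stub_affineCase a b c d ε hc0 hd0 S hS p
    have hdom' : r'.domain = S '' r.domain := by
      rw [hdom]
      exact image_congr hgS
    exact (simil_transport hα hβ hα0 hε S hS r hσ hint).2 r' hdom' hint'
  · -- big Bruhat cell: similarity, inversion, similarity
    have hα₂ : IsAlgebraic ℚ (-(a * d - b * c) / c) := by
      have hKalg : IsAlgebraic ℚ (a * d - b * c) := (ha.mul hd).sub (hb.mul hc)
      simpa [div_eq_mul_inv] using hKalg.neg.mul hc.inv
    have hβ₂ : IsAlgebraic ℚ (a / c) := by simpa [div_eq_mul_inv] using ha.mul hc.inv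
    have hα₂0 : -(a * d - b * c) / c ≠ 0 := div_ne_zero (neg_ne_zero.mpr hdet) hc0
    obtain ⟨S₁, hS₁⟩ := hSim c d ε
    obtain ⟨S₂, hS₂⟩ := hSim (-(a * d - b * c) / c) (a / c) 1
    -- first move: `S₁ = S(c, d, ε)`
    obtain ⟨⟨r₁, hr₁dom, hr₁int⟩, hmove₁⟩ := simil_transport hc hd hc0 hε S₁ hS₁ r hσ hint
    have hσ₁ : r₁.domain ⊆ {p | 0 < p 2} := hr₁dom ▸ simil_image_subset hc0 S₁ hS₁ hσ
    have h₁ : KZ.Equivalent r r₁ := hmove₁ r₁ hr₁dom hr₁int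
    -- second move: the inversion
    obtain ⟨⟨r₂, hr₂dom, hr₂int⟩, hmove₂⟩ := inversion_transport J hJ r₁ hσ₁ hr₁int
    have hσ₂ : r₂.domain ⊆ {p | 0 < p 2} := hr₂dom ▸ inversion_image_subset J hJ hσ₁
    have h₂ : KZ.Equivalent r₁ r₂ := hmove₂ r₂ hr₂dom hr₂int
    -- third move: `S₂ = S(−(ad−bc)/c, a/c, 1)`, landing on the GIVEN `r'`
    have hgS : EqOn g (S₂ ∘ J ∘ S₁) r.domain := fun p hp => by
      rw [hg p]
      exact stub_bruhatFactorisation a b c d ε hc0 S₁ J S₂ hS₁ hJ hS₂ p (hσ hp)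
    have hdom' : r'.domain = S₂ '' r₂.domain := by
      rw [hdom, image_congr hgS, hr₂dom, hr₁dom, image_image, image_image]
      rfl
    have h₃ : KZ.Equivalent r₂ r' := (simil_transport hα₂ hβ₂ hα₂0 (Or.inl rfl) S₂ hS₂ r₂ hσ₂ hr₂int).2
      r' hdom' hint'
    exact (h₁.trans h₂).trans h₃

end Summit.KontsevichZagierPeriods.HyperbolicBloch.IsometryMove

end
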